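import Mathlib
import Literature.NumberTheory.Transcendental.KZCalculus
import Literature.NumberTheory.Transcendental.KZRelationsLE
import Literature.NumberTheory.Transcendental.BoxIntegralHurwitzWeightTwo
import Summits.KontsevichZagierPeriods.KontsevichZagierPeriods.Theses.HurwitzMicroSectors

/-!
# Crux SectorTwoSix (stmt-KontsevichZagierPeriods-3870) — crux-ideate round 1, ideator 1: first lemmas

Two levers, each with its first checkable statement over existing declarations:

* **A. `jacobian-monomial-absorption`** — `t^k = (k+1)^{-2} · |det DΦ_{k+1}|` for the dilation
  `Φ_{k+1}(x, y) = (x^{k+1}, y^{k+1})` of the open box, and constants pull back to constants, so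
  `[box, c·t^k] − [box, c/(k+1)²]` is ONE change-of-variables move: the polynomial part of a sector
  integrand never needs rule 3) (Newton–Leibniz), never leaves dimension 2, never leaves the box.
  First lemma `MonomialAbsorption`, PROVED below from the route's engine `DilationMove` (item 3872).
* **B. `scaling-linear-syzygy-squeeze`** — the in-tree scaling endomorphism `KZ.scale`
  (`scale_mem_relations`) makes the syzygy set `K = {D ∈ ℚ[t] | every rep [box, D(t)/(1−t⁶)] is a
  relation}` a `ℚ`-SUBSPACE of `ℚ[t]`; the crux becomes `ker(value) ⊆ K`, settled by a codimension
  squeeze in the polynomial ring against CDT. First lemma `SectorKernelIsSubmodule` (statement);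
  the squeeze `SectorKernelSqueeze` (statement) and the glue `SectorKernelSqueeze → SectorTwoSix`
  PROVED below (modulo existence of sector reps, `SectorRepExists`, itself routine).
-/

open Set MeasureTheory
open Literature.NumberTheory.Transcendental
open Summit.KontsevichZagierPeriods.KontsevichZagierPeriods.Theses.HurwitzMicroSectors

namespace Summit.KontsevichZagierPeriods.KontsevichZagierPeriods.Cruxes.SectorTwoSix.Ideator1

/-! ### Lever A: monomial absorption -/

/-- **Monomial absorption** (first lemma of lever A): on the open unit box, for `c ∈ ℚ`, `k ∈ ℕ`,
`[box, c·(x₀x₁)^k] − [box, c/(k+1)²]` is a single change-of-variables move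
(`Φ(x) = (x₀^{k+1}, x₁^{k+1})`, `|det DΦ| = (k+1)² (x₀x₁)^k`). -/
def MonomialAbsorption : Prop :=
  ∀ (k : ℕ) (c : ℚ) (r r' : KZ.IntegralRep 2),
    r.domain = {x | ∀ i, x i ∈ Set.Ioo (0:ℝ) 1} → r'.domain = {x | ∀ i, x i ∈ Set.Ioo (0:ℝ) 1} →
    Set.EqOn r.integrand (fun x => (c : ℝ) * (x 0 * x 1) ^ k) r.domain →
    Set.EqOn r'.integrand (fun _ => (c : ℝ) / ((k : ℝ) + 1) ^ 2) r'.domain →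
    KZ.of r - KZ.of r' ∈ KZ.changeOfVariablesRel

/-- Lever A's first lemma is an instance of the route's engine `DilationMove` (item 3872) with
`n = 2`, `m = k + 1` and the CONSTANT target integrand. -/
theorem monomialAbsorption_of_dilationMove (hD : DilationMove) : MonomialAbsorption := by
  intro k c r r' hr hr' hf hf'
  refine hD 2 (k + 1) (Nat.succ_pos k) r r' hr hr' ?_
  intro x hx
  have hxbox : ∀ i, x i ∈ Set.Ioo (0:ℝ) 1 := by rw [hr] at hx; exact hx
  have hΦ : (fun i => x i ^ (k + 1)) ∈ r'.domain := by
    rw [hr']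
    intro i
    exact ⟨pow_pos (hxbox i).1 _, pow_lt_one₀ (hxbox i).1.le (hxbox i).2 (Nat.succ_ne_zero k)⟩
  rw [hf hx, hf' hΦ]
  simp only [Nat.add_sub_cancel, Fin.prod_univ_two]
  have hk : ((k : ℝ) + 1) ≠ 0 := by positivity
  push_cast
  field_simp
  ring

/-- The sub-calculus consequence lever A aims at (stated, not proved here): on the `(2,6)` sector,
equal values give a chain inside the subgroup generated by integrand additivity and changes of
variables ALONE (no rule 1a, no rule 3), hence a fortiori `KZ.Equivalent`. -/
def SectorTwoSixScissorsStokesFree : Prop :=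
  LinearIndependent ℚ ![(1 : ℝ), Real.pi ^ 2, (∑' n : ℕ, (1 / (3 * (n : ℝ) + 1) ^ 2 - 1 / (3 * (n : ℝ) + 2) ^ 2))] →
  ∀ (r r' : KZ.IntegralRep 2) (P P' : Polynomial ℚ),
    r.domain = {x | ∀ i, x i ∈ Set.Ioo (0:ℝ) 1} → r'.domain = {x | ∀ i, x i ∈ Set.Ioo (0:ℝ) 1} →
    Set.EqOn r.integrand (fun x => Polynomial.aeval (x 0 * x 1) P / (1 - (x 0 * x 1) ^ 6)) r.domain →
    Set.EqOn r'.integrand (fun x => Polynomial.aeval (x 0 * x 1) P' / (1 - (x 0 * x 1) ^ 6)) r'.domain →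
    r.value = r'.value →
    KZ.of r - KZ.of r' ∈ AddSubgroup.closure (KZ.integrandAddRel ∪ KZ.changeOfVariablesRel)

/-- The strengthening implies the crux (closure of a smaller generating set). -/
theorem sectorTwoSix_of_scissorsStokesFree (h : SectorTwoSixScissorsStokesFree) : SectorTwoSix := by
  intro hCDT r r' P P' hr hr' hf hf' hv
  have hle : AddSubgroup.closure (KZ.integrandAddRel ∪ KZ.changeOfVariablesRel) ≤ KZ.relations := by
    refine (AddSubgroup.closure_le _).mpr ?_
    rintro c (hc | hc)
    · exact KZ.integrandAddRel_subset_relations hc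
    · exact KZ.changeOfVariablesRel_subset_relations hc
  exact hle (h hCDT r r' P P' hr hr' hf hf' hv)

/-! ### Lever B: scaling-linearity and the syzygy squeeze in `ℚ[t]` -/

/-- A representation is a `(2,6)`-sector representation with numerator `D ∈ ℚ[t]`: domain the open
unit box, integrand `D(x₀x₁)/(1 − (x₀x₁)⁶)` on it. -/
def IsSectorRep (D : Polynomial ℚ) (r : KZ.IntegralRep 2) : Prop :=
  r.domain = {x | ∀ i, x i ∈ Set.Ioo (0:ℝ) 1} ∧
    Set.EqOn r.integrand (fun x => Polynomial.aeval (x 0 * x 1) D / (1 - (x 0 * x 1) ^ 6)) r.domain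

/-- Routine existence: every `D ∈ ℚ[t]` has a sector representation (the integrand is dominated by
`(Σ|d_k|)/(1 − x₀x₁)`, integrable by `BoxIntegral.integrableOn_box_pow_div_one_sub_pow`). -/
def SectorRepExists : Prop :=
  ∀ D : Polynomial ℚ, ∃ r : KZ.IntegralRep 2, IsSectorRep D r

/-- **First lemma of lever B**: the syzygy set `K = {D | every sector rep of D is a relation}` is a
`ℚ`-subspace of `ℚ[t]` (zero: the zero rep; add: one integrand-additivity move; smul: the scaling
endomorphism `KZ.scale` / `KZ.IntegralRep.constMul`, `KZ.scale_mem_relations`, in tree). -/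
def SectorKernelIsSubmodule : Prop :=
  ∃ K : Submodule ℚ (Polynomial ℚ), ∀ D : Polynomial ℚ,
    D ∈ K ↔ ∀ r : KZ.IntegralRep 2, IsSectorRep D r → KZ.of r ∈ KZ.relations

/-- The generators of the move-subspace `U ⊆ K`: monomial absorption `t^k − t^{k+6} − (k+1)^{-2}(1 − t⁶)`
(`k ≥ 1`), the three `m = 2` distribution polynomials `t^s + t^{s+3} − 4t^{2s+1}` and the two `m = 3`
ones `t^s + t^{s+2} + t^{s+4} − 9t^{3s+2}`. -/
def sectorGenerators : Set (Polynomial ℚ) :=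
  {D | ∃ k : ℕ, 1 ≤ k ∧ D = Polynomial.X ^ k - Polynomial.X ^ (k + 6)
      - Polynomial.C ((1 : ℚ) / ((k : ℚ) + 1) ^ 2) * (1 - Polynomial.X ^ 6)} ∪
  {D | ∃ s : ℕ, s ≤ 2 ∧ D = Polynomial.X ^ s + Polynomial.X ^ (s + 3) - 4 * Polynomial.X ^ (2 * s + 1)} ∪
  {D | ∃ s : ℕ, s ≤ 1 ∧ D = Polynomial.X ^ s + Polynomial.X ^ (s + 2) + Polynomial.X ^ (s + 4)
      - 9 * Polynomial.X ^ (3 * s + 2)}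

/-- Pure polynomial algebra (no measure theory): modulo the span of the generators every `D` is
`α t³ + β t⁵ + γ (1 − t⁶)`. -/
def SectorAlgebraicNormalForm : Prop :=
  ∀ D : Polynomial ℚ, ∃ α β γ : ℚ,
    D - (Polynomial.C α * Polynomial.X ^ 3 + Polynomial.C β * Polynomial.X ^ 5
      + Polynomial.C γ * (1 - Polynomial.X ^ 6)) ∈ Submodule.span ℚ sectorGenerators

/-- **The squeeze** (lever B's form of the crux): under CDT, a sector numerator of value zero is a
syzygy — every sector rep of it is a relation. -/
def SectorKernelSqueeze : Prop :=
  LinearIndependent ℚ ![(1 : ℝ), Real.pi ^ 2, (∑' n : ℕ, (1 / (3 * (n : ℝ) + 1) ^ 2 - 1 / (3 * (n : ℝ) + 2) ^ 2))] →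
  ∀ D : Polynomial ℚ,
    (∫ x in {x : Fin 2 → ℝ | ∀ i, x i ∈ Set.Ioo (0:ℝ) 1},
        Polynomial.aeval (x 0 * x 1) D / (1 - (x 0 * x 1) ^ 6)) = 0 →
    ∀ r : KZ.IntegralRep 2, IsSectorRep D r → KZ.of r ∈ KZ.relations

/-- **Glue of lever B** (proved): the squeeze implies the crux — `[r] − [r'] − [d]` is one
integrand-additivity move for `d` a sector rep of `P − P'`, `d` has value `0` by soundness, so
`[d]` is a relation and `[r] − [r']` too. -/
theorem sectorTwoSix_of_squeeze (hE : SectorRepExists) (hS : SectorKernelSqueeze) : SectorTwoSix := by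
  intro hCDT r r' P P' hr hr' hf hf' hv
  obtain ⟨d, hdD, hdf⟩ := hE (P - P')
  have hbox : ∀ x : Fin 2 → ℝ, (∀ i, x i ∈ Set.Ioo (0:ℝ) 1) → (1 - (x 0 * x 1) ^ 6 : ℝ) ≠ 0 := by
    intro x hx
    have ht := BoxIntegral.mul_mem_Ioo_of_mem_box hx
    have : (x 0 * x 1) ^ 6 < 1 := pow_lt_one₀ ht.1.le ht.2 (by norm_num)
    linarith
  -- one integrand-additivity move: [r] - [r'] - [d]
  have hadd : KZ.of r - KZ.of r' - KZ.of d ∈ KZ.integrandAddRel := by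
    refine ⟨2, r, r', d, hr'.trans hr.symm, hdD.trans hr.symm, fun x hx => ?_, rfl⟩
    have hxb : ∀ i, x i ∈ Set.Ioo (0:ℝ) 1 := by rw [hr] at hx; exact hx
    have hx' : x ∈ r'.domain := by rw [hr']; exact hxb
    have hxd : x ∈ d.domain := by rw [hdD]; exact hxb
    simp only [Pi.add_apply, hf hx, hf' hx', hdf hxd, map_sub]
    ring
  have hrel : KZ.of r - KZ.of r' - KZ.of d ∈ KZ.relations :=
    KZ.integrandAddRel_subset_relations hadd
  -- soundness: d has value 0
  have h0 : r.value - r'.value - d.value = 0 := by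
    have := KZ.relations_le_ker_eval_holds hrel
    rwa [AddMonoidHom.mem_ker, map_sub, map_sub, KZ.eval_of, KZ.eval_of, KZ.eval_of] at this
  have hdv : d.value = 0 := by linarith
  have hval : (∫ x in {x : Fin 2 → ℝ | ∀ i, x i ∈ Set.Ioo (0:ℝ) 1},
      Polynomial.aeval (x 0 * x 1) (P - P') / (1 - (x 0 * x 1) ^ 6)) = 0 := by
    have hm : MeasurableSet d.domain := KZ.IntegralRep.measurableSet_domain_holds d
    have : d.value = ∫ x in d.domain,
        Polynomial.aeval (x 0 * x 1) (P - P') / (1 - (x 0 * x 1) ^ 6) :=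
      setIntegral_congr_fun hm hdf
    rw [← hdD, ← this, hdv]
  have hd : KZ.of d ∈ KZ.relations := hS hCDT (P - P') hval d ⟨hdD, hdf⟩
  have : KZ.of r - KZ.of r' = (KZ.of r - KZ.of r' - KZ.of d) + KZ.of d := by abel
  show KZ.of r - KZ.of r' ∈ KZ.relations
  rw [this]
  exact KZ.relations.add_mem hrel hd

end Summit.KontsevichZagierPeriods.KontsevichZagierPeriods.Cruxes.SectorTwoSix.Ideator1
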